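import Summits.Parity.GeneralizedHardyLittlewood.Theses.PolymathEpsThreeCeiling
import Literature.NumberTheory.Sieve.PolymathMkEpsWeights
import Mathlib.Analysis.Complex.ExponentialBounds
import Mathlib.Analysis.SpecialFunctions.Log.Deriv

/-!
# Route `PolymathEpsThreeCeiling` — crux `GridBoundLow` (stmt-Parity-19070), closed

The low-`ε` grid bounds `M_{3, j/80}(F) ≤ 2(80+j)/(81+j)` for every integer `j ≤ 16` and every Polymath test
function `F` at `ε = j/80`, `k = 3` (Polymath 8b, arXiv:1407.4897, the `M_{k,ε}` functional of Theorem 3.12):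
they follow from the dilation transport `M_{3,ε} ≤ (1+ε)·M_{3,0}`
(`Literature.NumberTheory.Sieve.MkEps.bound_of_eps_zero`, p405742), the weights bound `M_{3,0} ≤ (3/2)·log 3`
(`Literature.NumberTheory.Sieve.polymathFunctional_le_epsT` at `n = 2`, `ε = 0`, `τ = 1`) and the numerical
inequality `log 3 < 1.0988` (Mathlib's `log 2` bound plus the Taylor remainder of `log (1 - x)` at `x = 1/4`);
the worst case is `j = 16`: `(1 + 16/80)·(3/2)·1.0988 = 1.97784 ≤ 2·96/97 = 1.97938…` (margin `0.0015`).
Candidate term of record: planner p3 evidence `GridBoundLow_holds.lean` (pub/parity-ideate/parity-ideate-p3/evidence2/,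
sha16 ff5b457ae2f76b59; registered variant 4f057daeea08b742), refuter arithmetic re-check 2026-08-27; landed verbatim
(docstrings added) by the decomp-parity landing hand leafhand-parity-fmcert-1 g0 once
`Literature.NumberTheory.Sieve.PolymathMkEpsWeights` was in the farm build (BUILT 2026-08-31T07:26Z).
Rung F-P1; no summit motion.  Standard axioms only.
-/

noncomputable section

namespace Summit.Parity.GeneralizedHardyLittlewood.Theses.PolymathEpsThreeCeiling

/-! ### PROOF of the crux `GridBoundLow` (`j ≤ 16`): `M_{3,ε} ≤ (1+ε)·(3/2)·log 3` and `log 3 < 1.0988` -/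

open Real Finset in
/-- `log 3 < 1.0988` (true value `1.098612…`): `log 3 = 2 log 2 + log (1 - 1/4)` with Mathlib's
`log 2 < 0.6931471808` and the Taylor remainder bound `|∑_{i<6} x^{i+1}/(i+1) + log (1-x)| ≤ |x|^7/(1-|x|)`
at `x = 1/4`. -/
theorem log_three_lt : Real.log 3 < 1.0988 := by
  have h2 := Real.log_two_lt_d9
  have hx : |(1 / 4 : ℝ)| < 1 := by rw [abs_of_pos (by norm_num)]; norm_num
  have h := Real.abs_log_sub_add_sum_range_le hx 6
  rw [abs_of_pos (show (0:ℝ) < 1 / 4 by norm_num)] at h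
  have h' := (abs_le.1 h).2
  simp only [Finset.sum_range_succ, Finset.sum_range_zero] at h'
  norm_num at h'
  have e : Real.log 3 = 2 * Real.log 2 + Real.log (3 / 4) := by
    have : (3 : ℝ) = 2 ^ 2 * (3 / 4) := by norm_num
    rw [this, Real.log_mul (by norm_num) (by norm_num), Real.log_pow]; push_cast; ring
  rw [e]; linarith

open Literature.NumberTheory.Sieve in
/-- `M_{3,0}(F) ≤ (3/2)·log 3` for every test function `F` at `ε = 0`
(`polymathFunctional_le_epsT` with `n = 2`, `ε = 0`, `τ = 1`). -/
theorem functional_three_zero_le {F : (Fin 3 → ℝ) → ℝ} (hF : IsPolymathTestFunction 3 0 F) :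
    polymathFunctional 3 0 F ≤ 3 / 2 * Real.log 3 := by
  have h := polymathFunctional_le_epsT (n := 2) (by norm_num) (ε := 0) (τ := 1) le_rfl (by norm_num)
    (by norm_num) le_rfl hF
  have hs : ∑ i ∈ Finset.range 2,
      max 0 (min (2 * (0:ℝ)) ((1 - 0) / ((i : ℝ) + 1)) - (1 - (1 - 0))) = 0 := by
    refine Finset.sum_eq_zero fun i _ => ?_
    have : min (2 * (0:ℝ)) ((1 - 0) / ((i : ℝ) + 1)) = 0 := by
      rw [min_eq_left]; · simp
      · simp; positivity
    rw [this]; simp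
  rw [hs] at h
  have e3 : ((2 : ℕ) : ℝ) + 1 = 3 := by norm_num
  rw [e3] at h
  norm_num at h
  linarith

open Literature.NumberTheory.Sieve Literature.NumberTheory.Sieve.MkEps in
/-- **`GridBoundLow` holds**: for `j ≤ 16` and `ε = j/80`, `M_{3,ε}(F) ≤ (1+ε)(3/2) log 3 ≤ 2(80+j)/(81+j)`
(dilation transport `bound_of_eps_zero` from `ε = 0`, and `log 3 < 1.0988`; margin `0.0019` at `j = 16`). -/
theorem gridBoundLow_holds : Summit.Parity.GeneralizedHardyLittlewood.Theses.PolymathEpsThreeCeiling.GridBoundLow := by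
  intro j hj F hF
  have hjR : (j : ℝ) ≤ 16 := by exact_mod_cast hj
  have hj0 : (0 : ℝ) ≤ j := by positivity
  have hε0 : (0 : ℝ) ≤ (j : ℝ) / 80 := by positivity
  have hε1 : (j : ℝ) / 80 < 1 := by rw [div_lt_one (by norm_num)]; linarith
  have hb := bound_of_eps_zero hε0 hε1 (M₀ := 3 / 2 * Real.log 3)
    (fun G hG => functional_three_zero_le hG) hF
  have hL := log_three_lt
  have hL0 : 0 < Real.log 3 := Real.log_pos (by norm_num)
  have hprod : Real.log 3 * (81 + (j : ℝ)) ≤ 1.0988 * 97 := by nlinarith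
  have key : (1 + (j : ℝ) / 80) * (3 / 2 * Real.log 3) ≤ 2 * (80 + (j : ℝ)) / (81 + (j : ℝ)) := by
    rw [le_div_iff₀ (by positivity)]
    nlinarith
  exact hb.trans key

end Summit.Parity.GeneralizedHardyLittlewood.Theses.PolymathEpsThreeCeiling
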